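import Summits.CriticalPhenomena.PercolationContinuityZ3.Theorems.PercAnnulusCrossingIICLevelJunk
import HarnessLib

/-!
# Kesten–Basu–Sapozhnikov IIC scheme in boxes, NEAR-CRITICAL series I: the junk of one level priced by the CONDITIONAL
# non-uniqueness `√P(NONUNIQ)` instead of the crossing probability (lane RSW3, p1 gen 6)

builds on p205010 (kernel theorem, internal audit signed; external expert review pending)

Seat `prim-rsw3-p1` (gen 6).  Parts VI/VI′ (`PercAnnulusCrossingIICLevelJunk.lean`, `…AspectLevelJunk.lean`) price the junk of one level of
Kesten's scheme by the annulus-CROSSING probability `α(a,b) = P(Λ(a) ↔ ∂ⁱⁿΛ(b))`, which is small only when `θ(p) = 0`.  Basu–Sapozhnikov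
(ECP 22 (2017) §2, eq. (2.4)) price it by the CONDITIONAL non-uniqueness `ε = P(F_i^c | A_i crossed) ≤ P(E_2)^{1/2}` (their (4), a BK square),
which is small at EVERY `p` by uniqueness of the infinite cluster — this is what makes their scheme run uniformly on `[p_c, p_c + δ]` and gives
Kesten's second construction `lim_{p ↓ p_c} P_p(E | |C(0)| = ∞)`.  This file is the one-line change at the bottom of the level-junk estimate:
with the BK square `P(NONUNIQ(a,b)) ≤ P(CANN(a,b))²` of part V (`real_nonuniq_le_sq`) one EANN-crossing is recombined by (A2)□ as before and the
other is paid for by `√P(NONUNIQ(a,b))` rather than by `P(CANN(a,b)) ≤ α(a,b)`.  Helper file; no definitions, no sorries; every `p`, `d`;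
abstract middle-sphere / outer-radius maps `σ, τ` (`m < σ m < τ m`), as in the general-aspect series.
* **`real_conn_inter_nonuniq_le_sqrt_of_setToSetQM_aspect`** — with `a = σ m₁`, `b = σ m₂`, `m₁ ≤ m₂`, `τ m₁ < b`, `τ m₂ < n`, `X ⊆ Λ(m₁)`,
  `X ∩ H = ∅`, `H ⊆ Λ(m₁ − 1)`:  `ϰ² · P(CONN(H,X;n) ∩ NONUNIQ(a,b)) ≤ √P(NONUNIQ(a,b)) · P(CONN(H,X;n))` (Basu–Sapozhnikov (2.4) with
  `ε_i = √P(E_2)`);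
* `sqrt_real_nonuniq_le_real_cann`, `sqrt_real_nonuniq_le_boxCrossing` — `√P(NONUNIQ(a,b)) ≤ P(CANN(a,b)) ≤ α(a,b)`: the new price never
  exceeds the old one, so parts VI′–XX′ are the special case of the near-critical series II–VII (which carry an ABSTRACT junk weight).
References: D. Basu, A. Sapozhnikov, ECP 22 (2017) no. 26, §1 eq. (4), §2 eq. (2.4); H. Kesten, PTRF 73 (1986) §2; G. Grimmett (1999), §2.2–2.3.
-/

noncomputable section

namespace Summit.CriticalPhenomena.PercolationContinuityZ3.Theorems.Crossing

open MeasureTheory Literature.Probability.Percolation Literature.Probability.LatticeModels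
open Literature.Probability.Percolation.DCT16
open Summit.CriticalPhenomena.PercolationContinuityZ3.Theorems.SurfaceTension
open scoped Literature.Probability.Percolation

variable {d : ℕ}

/-! ## Recombination by (A2)□ -/

/-- **The junk of one level under (A2)□, priced by `√P(NONUNIQ)`**: see the module docstring.
[cite: BasuSapozhnikov2017ECP, §1 eq. (4) and §2 eq. (2.4)] -/
theorem real_conn_inter_nonuniq_le_sqrt_of_setToSetQM_aspect (p : unitInterval) {ϰ : ℝ} (hϰ : 0 ≤ ϰ)
    {σ τ : ℕ → ℕ} (hσ : ∀ m : ℕ, 1 ≤ m → m < σ m) (hστ : ∀ m : ℕ, 1 ≤ m → σ m < τ m)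
    (hA2 : ∀ m : ℕ, 1 ≤ m → ∀ Z : Finset (Site d), box d (τ m) \ box d (m - 1) ⊆ Z →
      ∀ X : Finset (Site d), X ⊆ Z ∩ box d m → ∀ Y : Finset (Site d), Y ⊆ Z \ box d (τ m) →
        ϰ * (bondPercolation (zdGraph d) p).real {ω | ∃ x ∈ X, ∃ s ∈ innerBoundary (zdGraph d) (box d (σ m)),
              ω ∈ openConnIn (↑Z : Set (Site d)) x s} *
          (bondPercolation (zdGraph d) p).real {ω | ∃ y ∈ Y, ∃ s ∈ innerBoundary (zdGraph d) (box d (σ m)),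
              ω ∈ openConnIn (↑Z : Set (Site d)) y s} ≤
        (bondPercolation (zdGraph d) p).real {ω | ∃ x ∈ X, ∃ y ∈ Y, ω ∈ openConnIn (↑Z : Set (Site d)) x y})
    {m₁ m₂ n : ℕ} (hm₁ : 1 ≤ m₁) (hm₁₂ : m₁ ≤ m₂) (h12 : τ m₁ < σ m₂) (hn : τ m₂ < n)
    {H X : Finset (Site d)} (hH : H ⊆ box d (m₁ - 1)) (hX : X ⊆ box d m₁) (hXH : ∀ x ∈ X, x ∉ H) :
    ϰ ^ 2 * (bondPercolation (zdGraph d) p).real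
        ({ω : BondConfig (Site d) | ∃ x ∈ X, ∃ t ∈ innerBoundary (zdGraph d) (box d n),
            ω ∈ openConnIn ((↑(box d n) : Set (Site d)) \ ↑H) x t} ∩
         {ω : BondConfig (Site d) | ∃ t₁ ∈ innerBoundary (zdGraph d) (box d (σ m₁)), ∃ w₁ ∈ innerBoundary (zdGraph d) (box d (σ m₂)),
            ∃ t₂ ∈ innerBoundary (zdGraph d) (box d (σ m₁)), ∃ w₂ ∈ innerBoundary (zdGraph d) (box d (σ m₂)),
            ω ∩ {e : Sym2 (Site d) | e ∈ (↑((box d (σ m₂)).sym2) : Set (Sym2 (Site d))) ∧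
                ¬ (∀ v ∈ e, v ∈ box d (σ m₁)) ∧ ¬ (∀ v ∈ e, v ∈ innerBoundary (zdGraph d) (box d (σ m₂)))} ∈
              openConnIn (↑(box d (σ m₂)) : Set (Site d)) t₁ w₁ ∧
            ω ∩ {e : Sym2 (Site d) | e ∈ (↑((box d (σ m₂)).sym2) : Set (Sym2 (Site d))) ∧
                ¬ (∀ v ∈ e, v ∈ box d (σ m₁)) ∧ ¬ (∀ v ∈ e, v ∈ innerBoundary (zdGraph d) (box d (σ m₂)))} ∈
              openConnIn (↑(box d (σ m₂)) : Set (Site d)) t₂ w₂ ∧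
            ω ∩ {e : Sym2 (Site d) | e ∈ (↑((box d (σ m₂)).sym2) : Set (Sym2 (Site d))) ∧
                ¬ (∀ v ∈ e, v ∈ box d (σ m₁)) ∧ ¬ (∀ v ∈ e, v ∈ innerBoundary (zdGraph d) (box d (σ m₂)))} ∉
              openConnIn (↑(box d (σ m₂)) : Set (Site d)) w₁ w₂}) ≤
      Real.sqrt ((bondPercolation (zdGraph d) p).real
        {ω : BondConfig (Site d) | ∃ t₁ ∈ innerBoundary (zdGraph d) (box d (σ m₁)), ∃ w₁ ∈ innerBoundary (zdGraph d) (box d (σ m₂)),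
            ∃ t₂ ∈ innerBoundary (zdGraph d) (box d (σ m₁)), ∃ w₂ ∈ innerBoundary (zdGraph d) (box d (σ m₂)),
            ω ∩ {e : Sym2 (Site d) | e ∈ (↑((box d (σ m₂)).sym2) : Set (Sym2 (Site d))) ∧
                ¬ (∀ v ∈ e, v ∈ box d (σ m₁)) ∧ ¬ (∀ v ∈ e, v ∈ innerBoundary (zdGraph d) (box d (σ m₂)))} ∈
              openConnIn (↑(box d (σ m₂)) : Set (Site d)) t₁ w₁ ∧
            ω ∩ {e : Sym2 (Site d) | e ∈ (↑((box d (σ m₂)).sym2) : Set (Sym2 (Site d))) ∧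
                ¬ (∀ v ∈ e, v ∈ box d (σ m₁)) ∧ ¬ (∀ v ∈ e, v ∈ innerBoundary (zdGraph d) (box d (σ m₂)))} ∈
              openConnIn (↑(box d (σ m₂)) : Set (Site d)) t₂ w₂ ∧
            ω ∩ {e : Sym2 (Site d) | e ∈ (↑((box d (σ m₂)).sym2) : Set (Sym2 (Site d))) ∧
                ¬ (∀ v ∈ e, v ∈ box d (σ m₁)) ∧ ¬ (∀ v ∈ e, v ∈ innerBoundary (zdGraph d) (box d (σ m₂)))} ∉
              openConnIn (↑(box d (σ m₂)) : Set (Site d)) w₁ w₂}) *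
        (bondPercolation (zdGraph d) p).real {ω : BondConfig (Site d) | ∃ x ∈ X, ∃ t ∈ innerBoundary (zdGraph d) (box d n),
            ω ∈ openConnIn ((↑(box d n) : Set (Site d)) \ ↑H) x t} := by
  classical
  have hσ1 := hσ m₁ hm₁
  have hστ1 := hστ m₁ hm₁
  have hσ2 := hσ m₂ (by omega)
  have hστ2 := hστ m₂ (by omega)
  set μ := bondPercolation (zdGraph d) p with hμ
  set a := σ m₁ with ha
  set b := σ m₂ with hb
  have ha1 : 1 ≤ a := by omega
  have hab : a ≤ b - 1 := by omega
  have hbn : b ≤ n := by omega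
  have hHa : H ⊆ box d (a - 1) := hH.trans (box_mono d (by omega))
  have hXa : X ⊆ box d a := hX.trans (box_mono d (by omega))
  set Z : Finset (Site d) := box d n \ H with hZ
  have hZcoe : (↑Z : Set (Site d)) = (↑(box d n) : Set (Site d)) \ ↑H := by rw [hZ, Finset.coe_sdiff]
  set EANN : Set (Sym2 (Site d)) := {e : Sym2 (Site d) | e ∈ (↑((box d b).sym2) : Set (Sym2 (Site d))) ∧
    ¬ (∀ v ∈ e, v ∈ box d a) ∧ ¬ (∀ v ∈ e, v ∈ innerBoundary (zdGraph d) (box d b))} with hEANN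
  set CONN := {ω : BondConfig (Site d) | ∃ x ∈ X, ∃ t ∈ innerBoundary (zdGraph d) (box d n),
    ω ∈ openConnIn ((↑(box d n) : Set (Site d)) \ ↑H) x t} with hCONN
  set PRE := {ω : BondConfig (Site d) | ∃ x ∈ X, ∃ s ∈ innerBoundary (zdGraph d) (box d a),
    ω ∈ openConnIn ((↑(box d a) : Set (Site d)) \ ↑H) x s} with hPRE
  set CANN := {ω : BondConfig (Site d) | ∃ t ∈ innerBoundary (zdGraph d) (box d a), ∃ w ∈ innerBoundary (zdGraph d) (box d b),
    ω ∩ EANN ∈ openConnIn (↑(box d b) : Set (Site d)) t w} with hCANN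
  set NU := {ω : BondConfig (Site d) | ∃ t₁ ∈ innerBoundary (zdGraph d) (box d a), ∃ w₁ ∈ innerBoundary (zdGraph d) (box d b),
    ∃ t₂ ∈ innerBoundary (zdGraph d) (box d a), ∃ w₂ ∈ innerBoundary (zdGraph d) (box d b),
    ω ∩ EANN ∈ openConnIn (↑(box d b) : Set (Site d)) t₁ w₁ ∧ ω ∩ EANN ∈ openConnIn (↑(box d b) : Set (Site d)) t₂ w₂ ∧
    ω ∩ EANN ∉ openConnIn (↑(box d b) : Set (Site d)) w₁ w₂} with hNU
  set TAIL := {ω : BondConfig (Site d) | ∃ s ∈ innerBoundary (zdGraph d) (box d b),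
    ∃ t ∈ innerBoundary (zdGraph d) (box d n), ω ∈ openConnIn ((↑(box d n) : Set (Site d)) \ ↑(box d (b - 1))) s t} with hTAIL
  -- the link events of (A2)□ in `Z`
  set LXa := μ.real {ω | ∃ x ∈ X, ∃ s ∈ innerBoundary (zdGraph d) (box d (σ m₁)), ω ∈ openConnIn (↑Z : Set (Site d)) x s} with hLXa
  set LBa := μ.real {ω | ∃ y ∈ innerBoundary (zdGraph d) (box d b), ∃ s ∈ innerBoundary (zdGraph d) (box d (σ m₁)),
    ω ∈ openConnIn (↑Z : Set (Site d)) y s} with hLBa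
  set LXb := μ.real {ω | ∃ x ∈ X, ∃ y ∈ innerBoundary (zdGraph d) (box d b), ω ∈ openConnIn (↑Z : Set (Site d)) x y} with hLXb
  set LXb' := μ.real {ω | ∃ x ∈ X, ∃ s ∈ innerBoundary (zdGraph d) (box d (σ m₂)), ω ∈ openConnIn (↑Z : Set (Site d)) x s} with hLXb'
  set LNb := μ.real {ω | ∃ y ∈ innerBoundary (zdGraph d) (box d n), ∃ s ∈ innerBoundary (zdGraph d) (box d (σ m₂)),
    ω ∈ openConnIn (↑Z : Set (Site d)) y s} with hLNb
  set LXn := μ.real {ω | ∃ x ∈ X, ∃ y ∈ innerBoundary (zdGraph d) (box d n), ω ∈ openConnIn (↑Z : Set (Site d)) x y} with hLXn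
  -- (A2)□ #1 at scale `m₁`, `Y = ∂ⁱⁿΛ(b)`
  have hZ1 : box d (τ m₁) \ box d (m₁ - 1) ⊆ Z := by
    intro z hz
    rw [Finset.mem_sdiff] at hz ⊢
    exact ⟨box_mono d (by omega) hz.1, fun h => hz.2 (hH h)⟩
  have hX1 : X ⊆ Z ∩ box d m₁ := fun x hx =>
    Finset.mem_inter.2 ⟨Finset.mem_sdiff.2 ⟨box_mono d (by omega) (hX hx), hXH x hx⟩, hX hx⟩
  have hY1 : innerBoundary (zdGraph d) (box d b) ⊆ Z \ box d (τ m₁) := by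
    intro y hy
    have hyb : y ∈ box d b := (Finset.mem_filter.1 hy).1
    have hyb1 : y ∉ box d (b - 1) := notMem_box_of_mem_innerBoundary_box (by omega) hy
    refine Finset.mem_sdiff.2 ⟨Finset.mem_sdiff.2 ⟨box_mono d hbn hyb, fun h => hyb1 (box_mono d (by omega) (hH h))⟩,
      fun h => hyb1 (box_mono d (by omega) h)⟩
  have key1 : ϰ * LXa * LBa ≤ LXb := hA2 m₁ hm₁ Z hZ1 X hX1 _ hY1
  -- (A2)□ #2 at scale `m₂`, `Y = ∂ⁱⁿΛ(n)`
  have hZ2 : box d (τ m₂) \ box d (m₂ - 1) ⊆ Z := by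
    intro z hz
    rw [Finset.mem_sdiff] at hz ⊢
    exact ⟨box_mono d hn.le hz.1, fun h => hz.2 (box_mono d (by omega) (hH h))⟩
  have hX2 : X ⊆ Z ∩ box d m₂ := fun x hx =>
    Finset.mem_inter.2 ⟨Finset.mem_sdiff.2 ⟨box_mono d (by omega) (hX hx), hXH x hx⟩, box_mono d (by omega) (hX hx)⟩
  have hY2 : innerBoundary (zdGraph d) (box d n) ⊆ Z \ box d (τ m₂) := by
    intro y hy
    have hyn : y ∈ box d n := (Finset.mem_filter.1 hy).1
    have hyn1 : y ∉ box d (n - 1) := notMem_box_of_mem_innerBoundary_box (by omega) hy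
    refine Finset.mem_sdiff.2 ⟨Finset.mem_sdiff.2 ⟨hyn, fun h => hyn1 (box_mono d (by omega) (hH h))⟩,
      fun h => hyn1 (box_mono d (by omega) h)⟩
  have key2 : ϰ * LXb' * LNb ≤ LXn := hA2 m₂ (by omega) Z hZ2 X hX2 _ hY2
  -- identifications / comparisons
  have e0 : LXb = LXb' := by rw [hLXb, hLXb']
  have e1 : μ.real PRE ≤ LXa := by
    refine measureReal_mono (fun ω hω => ?_) (measure_ne_top _ _)
    obtain ⟨x, hx, s, hs, h⟩ := hω
    refine ⟨x, hx, s, hs, openConnIn_mono ?_ _ _ h⟩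
    rw [hZcoe]; exact fun z hz => ⟨Finset.mem_coe.2 (box_mono d (by omega) (Finset.mem_coe.1 hz.1)), hz.2⟩
  have e2 : μ.real CANN ≤ LBa := by
    refine real_mono_of_forall_subset_edgeSet (zdGraph d) p fun ω hω h => ?_
    obtain ⟨t, ht, w, hw, htw⟩ := h
    have hωE : ω ∩ EANN ⊆ (zdGraph d).edgeSet := fun e he => hω he.1
    obtain ⟨q, hqS, hqE⟩ := exists_walk_of_mem_openConnIn hωE htw
    have hta1 : t ∉ box d (a - 1) := notMem_box_of_mem_innerBoundary_box (by omega) ht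
    have hsupp := notMem_box_pred_of_eann_walk (a := a) (b := b) ha1 q (fun e he => (hqE e he).2) hta1
    refine ⟨w, hw, t, ht, ?_⟩
    rw [openConnIn_comm]
    refine mem_openConnIn_of_walk q (fun z hz => ?_) (fun e he => (hqE e he).1)
    rw [hZcoe]
    exact ⟨Finset.mem_coe.2 (box_mono d hbn (Finset.mem_coe.1 (hqS z hz))), fun h => hsupp z hz (hHa (Finset.mem_coe.1 h))⟩
  have e3 : μ.real TAIL ≤ LNb := by
    refine measureReal_mono (fun ω hω => ?_) (measure_ne_top _ _)
    obtain ⟨s, hs, t, ht, h⟩ := hω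
    refine ⟨t, ht, s, hs, ?_⟩
    rw [openConnIn_comm]
    refine openConnIn_mono ?_ _ _ h
    rw [hZcoe]; exact fun z hz => ⟨hz.1, fun h' => hz.2 (Finset.mem_coe.2 (box_mono d (by omega) (hH (Finset.mem_coe.1 h'))))⟩
  have e4 : LXn = μ.real CONN := by rw [hLXn, hCONN, hZcoe]
  -- assemble
  have h3 := real_conn_inter_nonuniq_le_mul3 (d := d) p ha1 hab hbn hHa hXa
  have hNU := real_nonuniq_le_sq (d := d) p a b
  have hPRE0 : 0 ≤ μ.real PRE := measureReal_nonneg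
  have hTAIL0 : 0 ≤ μ.real TAIL := measureReal_nonneg
  have hCANN0 : 0 ≤ μ.real CANN := measureReal_nonneg
  have hLBa0 : 0 ≤ LBa := measureReal_nonneg
  have hLNb0 : 0 ≤ LNb := measureReal_nonneg
  have hS0 : 0 ≤ Real.sqrt (μ.real NU) := Real.sqrt_nonneg _
  -- Basu–Sapozhnikov (4): `P(NU) ≤ √P(NU) · P(CANN)` from the BK square
  have hSC : Real.sqrt (μ.real NU) ≤ μ.real CANN := by
    have h := Real.sqrt_le_sqrt hNU
    rwa [Real.sqrt_sq hCANN0] at h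
  have hNU' : μ.real NU ≤ Real.sqrt (μ.real NU) * μ.real CANN := by
    calc μ.real NU = Real.sqrt (μ.real NU) * Real.sqrt (μ.real NU) := (Real.mul_self_sqrt measureReal_nonneg).symm
      _ ≤ Real.sqrt (μ.real NU) * μ.real CANN := mul_le_mul_of_nonneg_left hSC hS0
  calc ϰ ^ 2 * μ.real (CONN ∩ NU) ≤ ϰ ^ 2 * (μ.real PRE * μ.real NU * μ.real TAIL) :=
        mul_le_mul_of_nonneg_left h3 (pow_nonneg hϰ 2)
    _ ≤ ϰ ^ 2 * (μ.real PRE * (Real.sqrt (μ.real NU) * μ.real CANN) * μ.real TAIL) := by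
        refine mul_le_mul_of_nonneg_left ?_ (pow_nonneg hϰ 2)
        exact mul_le_mul_of_nonneg_right (mul_le_mul_of_nonneg_left hNU' hPRE0) hTAIL0
    _ = Real.sqrt (μ.real NU) * (ϰ * (ϰ * μ.real PRE * μ.real CANN) * μ.real TAIL) := by ring
    _ ≤ Real.sqrt (μ.real NU) * (ϰ * (ϰ * LXa * LBa) * LNb) := by
        refine mul_le_mul_of_nonneg_left ?_ hS0
        refine mul_le_mul ?_ e3 hTAIL0 ?_
        · exact mul_le_mul_of_nonneg_left (mul_le_mul (mul_le_mul_of_nonneg_left e1 hϰ) e2 hCANN0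
            (mul_nonneg hϰ measureReal_nonneg)) hϰ
        · exact mul_nonneg hϰ (mul_nonneg (mul_nonneg hϰ measureReal_nonneg) hLBa0)
    _ ≤ Real.sqrt (μ.real NU) * (ϰ * LXb' * LNb) := by
        refine mul_le_mul_of_nonneg_left (mul_le_mul_of_nonneg_right ?_ hLNb0) hS0
        rw [← e0]; exact mul_le_mul_of_nonneg_left key1 hϰ
    _ ≤ Real.sqrt (μ.real NU) * μ.real CONN := by rw [← e4]; exact mul_le_mul_of_nonneg_left key2 hS0

/-! ## The new price never exceeds the old one -/

/-- **`√P(NONUNIQ(a,b)) ≤ P(CANN(a,b))`** (Basu–Sapozhnikov (4): the BK square `P(NONUNIQ) ≤ P(CANN)²` of part V, square-rooted).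
[cite: BasuSapozhnikov2017ECP, §1 eq. (4)] -/
theorem sqrt_real_nonuniq_le_real_cann (p : unitInterval) (a b : ℕ) :
    Real.sqrt ((bondPercolation (zdGraph d) p).real
        {ω : BondConfig (Site d) | ∃ t₁ ∈ innerBoundary (zdGraph d) (box d a), ∃ w₁ ∈ innerBoundary (zdGraph d) (box d b),
          ∃ t₂ ∈ innerBoundary (zdGraph d) (box d a), ∃ w₂ ∈ innerBoundary (zdGraph d) (box d b),
          ω ∩ {e : Sym2 (Site d) | e ∈ (↑((box d b).sym2) : Set (Sym2 (Site d))) ∧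
              ¬ (∀ v ∈ e, v ∈ box d a) ∧ ¬ (∀ v ∈ e, v ∈ innerBoundary (zdGraph d) (box d b))} ∈
            openConnIn (↑(box d b) : Set (Site d)) t₁ w₁ ∧
          ω ∩ {e : Sym2 (Site d) | e ∈ (↑((box d b).sym2) : Set (Sym2 (Site d))) ∧
              ¬ (∀ v ∈ e, v ∈ box d a) ∧ ¬ (∀ v ∈ e, v ∈ innerBoundary (zdGraph d) (box d b))} ∈
            openConnIn (↑(box d b) : Set (Site d)) t₂ w₂ ∧
          ω ∩ {e : Sym2 (Site d) | e ∈ (↑((box d b).sym2) : Set (Sym2 (Site d))) ∧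
              ¬ (∀ v ∈ e, v ∈ box d a) ∧ ¬ (∀ v ∈ e, v ∈ innerBoundary (zdGraph d) (box d b))} ∉
            openConnIn (↑(box d b) : Set (Site d)) w₁ w₂}) ≤
      (bondPercolation (zdGraph d) p).real
        {ω : BondConfig (Site d) | ∃ t ∈ innerBoundary (zdGraph d) (box d a), ∃ w ∈ innerBoundary (zdGraph d) (box d b),
          ω ∩ {e : Sym2 (Site d) | e ∈ (↑((box d b).sym2) : Set (Sym2 (Site d))) ∧
              ¬ (∀ v ∈ e, v ∈ box d a) ∧ ¬ (∀ v ∈ e, v ∈ innerBoundary (zdGraph d) (box d b))} ∈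
            openConnIn (↑(box d b) : Set (Site d)) t w} := by
  have h := Real.sqrt_le_sqrt (real_nonuniq_le_sq (d := d) p a b)
  rwa [Real.sqrt_sq measureReal_nonneg] at h

/-- **`√P(NONUNIQ(a,b)) ≤ α_p(a,b)`** (`a ≤ b`): the near-critical price of a level is at most the price `α(a,b) = P(Λ(a) ↔ ∂ⁱⁿΛ(b))` of
parts VI/VI′ — so every theorem of the near-critical series II–VII (abstract junk weight) specialises to the `θ(p) = 0` series.
[cite: BasuSapozhnikov2017ECP, §1 eq. (4), §2 eq. (2.4)] -/
theorem sqrt_real_nonuniq_le_boxCrossing (p : unitInterval) {a b : ℕ} (hab : a ≤ b) :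
    Real.sqrt ((bondPercolation (zdGraph d) p).real
        {ω : BondConfig (Site d) | ∃ t₁ ∈ innerBoundary (zdGraph d) (box d a), ∃ w₁ ∈ innerBoundary (zdGraph d) (box d b),
          ∃ t₂ ∈ innerBoundary (zdGraph d) (box d a), ∃ w₂ ∈ innerBoundary (zdGraph d) (box d b),
          ω ∩ {e : Sym2 (Site d) | e ∈ (↑((box d b).sym2) : Set (Sym2 (Site d))) ∧
              ¬ (∀ v ∈ e, v ∈ box d a) ∧ ¬ (∀ v ∈ e, v ∈ innerBoundary (zdGraph d) (box d b))} ∈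
            openConnIn (↑(box d b) : Set (Site d)) t₁ w₁ ∧
          ω ∩ {e : Sym2 (Site d) | e ∈ (↑((box d b).sym2) : Set (Sym2 (Site d))) ∧
              ¬ (∀ v ∈ e, v ∈ box d a) ∧ ¬ (∀ v ∈ e, v ∈ innerBoundary (zdGraph d) (box d b))} ∈
            openConnIn (↑(box d b) : Set (Site d)) t₂ w₂ ∧
          ω ∩ {e : Sym2 (Site d) | e ∈ (↑((box d b).sym2) : Set (Sym2 (Site d))) ∧
              ¬ (∀ v ∈ e, v ∈ box d a) ∧ ¬ (∀ v ∈ e, v ∈ innerBoundary (zdGraph d) (box d b))} ∉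
            openConnIn (↑(box d b) : Set (Site d)) w₁ w₂}) ≤
      (bondPercolation (zdGraph d) p).real (boxCrossing d a b) :=
  (sqrt_real_nonuniq_le_real_cann p a b).trans (real_cann_le_boxCrossing p hab)

end Summit.CriticalPhenomena.PercolationContinuityZ3.Theorems.Crossing

end
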